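import Summits.ResolutionOfSingularities.ResolutionOfSingularities.Theorems.FrobeniusClosingSteerBetaPolygonGauge
import Summits.ResolutionOfSingularities.ResolutionOfSingularities.Theorems.FrobeniusClosingSteerBetaPolygonFiltration
import HarnessLib

/-!
# Crux `Steer` (stmt-ResolutionOfSingularities-16345), chain W4.1 — hK4′ β-leaf, K-β1♭ GAUGE SIDE (G1) on the WORDS:
# `α ≥ ρ`, `δ ≥ ρ`, `β ≥ ρ` do not see preparation moves of weight `≥ 1`; the bridges «`β > β₀`» ↔ the strict `β`-ideal

OURS (campaign `res-hironaka`, rung L ★L-G4, slot W4.1; seat res-L0-w41-stub-4 g7, second hand on K-β1♭ per res-L0-w41-plan-1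
RULINGS 142b / 143 / 147b / 150a / 157a, rows G1 / D of res-L0-w41-stub-1's `KBETA1-BLUEPRINT.md` 4807652a0eeb53d4; owner
res-L0-w41-stub-1 g4); replaces the role of no printed item; NOT a statement of the manuscript under review [claim: Hironaka2017,
status: under-review]; AI-produced, weaker than expert review. Theses-free and definition-free over the TREE words `AlphaGe` /
`DeltaGe` / `BetaGe` (`…FrobeniusClosingSteerBetaPolygonWords`, res-L0-w41-stub-1 p536143, VERBATIM res-L0-w41-idea-1 v17 §1), `BetaGt`
(`…FrobeniusClosingSteerBetaPolygonGauge`, res-L0-w41-stub-1 p540729, idea-1 v18 §2♭) and the words-free engine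
`…FrobeniusClosingSteerBetaPolygonFiltration` (p541135).

* **`alphaGe_move_iff`** (`φ, ψ ∈ (x^m)`, `ρ ≤ m`), **`deltaGe_move_iff`** (`φ, ψ ∈ (x, y)^m`, `ρ ≤ m`), **`betaGe_move_iff`**
  (`φ, ψ ∈ (x^(⌊α⌋+1)) + (x^⌈α⌉·y^⌈ρ⌉)`, `0 ≤ α`): `z ↦ z + φ`, `w ↦ w + ψ` does not change the predicate — the «Case p ≥ 1» half
  of the K-β1♭ invariance step (3a) at the IDEAL level (blueprint §2; the graded identity is res-L0-w41-stub-1's p539704).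
* bridges for brick D: `betaGe_of_mem_sup_betaStrict` (`f ∈ (z,w)^d + I⁺(z,w)` ⇒ `BetaGe … α ρ' f` whenever
  `⌈ρ'n⌉ ≤ ⌊β₀n⌋ + 1` for `1 ≤ n ≤ d` — with `β₀ ∈ (1/N)ℕ` any `ρ' ≤ β₀ + 1/(dN)`, the rounding of brick A),
  `mem_sup_betaStrict_of_betaGe` (converse for `ρ' > β₀`, cf. `floor_add_one_le_ceil_of_lt`), `alphaGe_of_mem_sup_betaStrict`
  (a dissolved representative keeps `α ≥ α`, so stays in the class `C` when `α = α*` is maximal).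

* §3 the same through res-L0-w41-stub-1's word `BetaGt` (`…BetaPolygonGauge` §2♭): `betaGt_iff_mem_sup_betaStrict`
  (`BetaGt` = `(z,w)^d + I⁺(z,w)`), **`betaGt_sub_sq_of_dissolution`** (brick D in the word), `betaGe_of_betaGt` (rounding window),
  `betaGt_of_betaGe_of_lt`, `betaGe_of_betaGt_self`, `alphaGe_of_betaGt`.

[cite: CossartJannsenSaito2020, Def. 11.1] [folklore]
bears_on: LADDER-RESOLUTION L ★L-G4 W4.1 (crux `Steer`, binder hK4′, debt K-β1♭ bricks G1 / D).
-/

noncomputable section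

-- `Summit.<S>.<S>.…` duplicates the summit name by design (single-problem summit).
set_option linter.dupNamespace false

open IsLocalRing

namespace Summit.ResolutionOfSingularities.ResolutionOfSingularities.Theorems.SwitchingDichotomy.BetaPolygonMoves

open Summit.ResolutionOfSingularities.ResolutionOfSingularities.Theorems.SwitchingDichotomy.BetaPolygon

variable {S : Type} [CommRing S]

/-! ## §1 Moves of weight `≥ 1` on the three words -/

/-- **`α ≥ ρ` is stable under preparation moves of `x`-order `≥ ρ`**: if `φ, ψ ∈ (x ^ m)` with `ρ ≤ m`, then
`AlphaGe x z w d ρ f ↔ AlphaGe x (z + φ) (w + ψ) d ρ f`. OURS. [folklore] -/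
theorem alphaGe_move_iff (x z w : S) {φ ψ : S} {m : ℕ} (hφ : φ ∈ Ideal.span {x ^ m})
    (hψ : ψ ∈ Ideal.span {x ^ m}) {ρ : ℚ} (hm : ρ ≤ m) (d : ℕ) (f : S) :
    AlphaGe x z w d ρ f ↔ AlphaGe x (z + φ) (w + ψ) d ρ f := by
  unfold AlphaGe
  have hw : ∀ (z w : S) (i j : ℕ), Ideal.span {x ^ ⌈ρ * ((d - i - j : ℕ) : ℚ)⌉₊ * z ^ i * w ^ j}
      = Ideal.span {x ^ ⌈ρ * ((d - i - j : ℕ) : ℚ)⌉₊} * Ideal.span {z ^ i * w ^ j} := by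
    intro z w i j; rw [Ideal.span_singleton_mul_span_singleton, mul_assoc]
  simp_rw [hw]
  have hC0 : Ideal.span {x ^ ⌈ρ * ((0 : ℕ) : ℚ)⌉₊} = (⊤ : Ideal S) := by simp
  have h1 : Ideal.span ({x ^ m} : Set S) ≤ Ideal.span {x ^ ⌈ρ * ((1 : ℕ) : ℚ)⌉₊} := by
    rw [Ideal.span_singleton_le_span_singleton, Nat.cast_one, mul_one]
    exact pow_dvd_pow x (Nat.ceil_le.mpr hm)
  rw [sup_iSup_eq_of_move (C := fun k => Ideal.span {x ^ ⌈ρ * (k : ℚ)⌉₊}) hC0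
    (fun a b => alphaCell_mul_le x ρ a b) z w (h1 hφ) (h1 hψ) d]

/-- **`δ ≥ ρ` is stable under preparation moves of `(x, y)`-order `≥ ρ`**: if `φ, ψ ∈ (x, y) ^ m` with `ρ ≤ m`, then
`DeltaGe x y z w d ρ f ↔ DeltaGe x y (z + φ) (w + ψ) d ρ f`. OURS. [folklore] -/
theorem deltaGe_move_iff (x y z w : S) {φ ψ : S} {m : ℕ} (hφ : φ ∈ Ideal.span {x, y} ^ m)
    (hψ : ψ ∈ Ideal.span {x, y} ^ m) {ρ : ℚ} (hm : ρ ≤ m) (d : ℕ) (f : S) :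
    DeltaGe x y z w d ρ f ↔ DeltaGe x y (z + φ) (w + ψ) d ρ f := by
  unfold DeltaGe
  have hC0 : Ideal.span ({x, y} : Set S) ^ ⌈ρ * ((0 : ℕ) : ℚ)⌉₊ = ⊤ := by simp
  have h1 : Ideal.span ({x, y} : Set S) ^ m ≤ Ideal.span {x, y} ^ ⌈ρ * ((1 : ℕ) : ℚ)⌉₊ := by
    rw [Nat.cast_one, mul_one]
    exact Ideal.pow_le_pow_right (Nat.ceil_le.mpr hm)
  rw [sup_iSup_eq_of_move (C := fun k => Ideal.span {x, y} ^ ⌈ρ * (k : ℚ)⌉₊) hC0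
    (fun a b => deltaCell_mul_le x y ρ a b) z w (h1 hφ) (h1 hψ) d]

/-- **`β ≥ ρ` on the column `a = α` is stable under preparation moves of `v`-weight `≥ 1`** (`v = (α, ρ)`, `0 ≤ α`):
if `φ, ψ ∈ (x ^ (⌊α⌋ + 1)) + (x ^ ⌈α⌉ · y ^ ⌈ρ⌉)` — monomials strictly right of the column, or on it and not below `ρ` —
then `BetaGe x y z w d α ρ f ↔ BetaGe x y (z + φ) (w + ψ) d α ρ f`. OURS. [folklore] -/
theorem betaGe_move_iff (x y z w : S) {α : ℚ} (hα : 0 ≤ α) (ρ : ℚ) {φ ψ : S}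
    (hφ : φ ∈ Ideal.span {x ^ (⌊α⌋₊ + 1)} ⊔ Ideal.span {x ^ ⌈α⌉₊ * y ^ ⌈ρ⌉₊})
    (hψ : ψ ∈ Ideal.span {x ^ (⌊α⌋₊ + 1)} ⊔ Ideal.span {x ^ ⌈α⌉₊ * y ^ ⌈ρ⌉₊}) (d : ℕ) (f : S) :
    BetaGe x y z w d α ρ f ↔ BetaGe x y (z + φ) (w + ψ) d α ρ f := by
  unfold BetaGe
  have hw : ∀ (z w : S) (i j : ℕ),
      Ideal.span {x ^ (⌊α * ((d - i - j : ℕ) : ℚ)⌋₊ + 1) * z ^ i * w ^ j} ⊔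
          Ideal.span {x ^ ⌈α * ((d - i - j : ℕ) : ℚ)⌉₊ * y ^ ⌈ρ * ((d - i - j : ℕ) : ℚ)⌉₊ * z ^ i * w ^ j}
        = (Ideal.span {x ^ (⌊α * ((d - i - j : ℕ) : ℚ)⌋₊ + 1)} ⊔
            Ideal.span {x ^ ⌈α * ((d - i - j : ℕ) : ℚ)⌉₊ * y ^ ⌈ρ * ((d - i - j : ℕ) : ℚ)⌉₊}) *
          Ideal.span {z ^ i * w ^ j} := by
    intro z w i j
    rw [Ideal.sup_mul, Ideal.span_singleton_mul_span_singleton, Ideal.span_singleton_mul_span_singleton,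
      mul_assoc, mul_assoc (x ^ _ * y ^ _)]
  simp_rw [hw]
  have hC0 : Ideal.span {x ^ (⌊α * ((0 : ℕ) : ℚ)⌋₊ + 1)} ⊔
      Ideal.span {x ^ ⌈α * ((0 : ℕ) : ℚ)⌉₊ * y ^ ⌈ρ * ((0 : ℕ) : ℚ)⌉₊} = (⊤ : Ideal S) := by simp
  have h1 : Ideal.span {x ^ (⌊α⌋₊ + 1)} ⊔ Ideal.span {x ^ ⌈α⌉₊ * y ^ ⌈ρ⌉₊} =
      Ideal.span {x ^ (⌊α * ((1 : ℕ) : ℚ)⌋₊ + 1)} ⊔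
        Ideal.span ({x ^ ⌈α * ((1 : ℕ) : ℚ)⌉₊ * y ^ ⌈ρ * ((1 : ℕ) : ℚ)⌉₊} : Set S) := by
    simp only [Nat.cast_one, mul_one]
  rw [h1] at hφ hψ
  rw [sup_iSup_eq_of_move
    (C := fun k => Ideal.span {x ^ (⌊α * (k : ℚ)⌋₊ + 1)} ⊔ Ideal.span {x ^ ⌈α * (k : ℚ)⌉₊ * y ^ ⌈ρ * (k : ℚ)⌉₊})
    hC0 (fun a b => betaCell_mul_le x y hα ρ a b) z w hφ hψ d]

/-! ## §2 Bridges between the word `BetaGe` and the strict `β`-ideal of brick D -/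

/-- Bridge: membership in `(z, w)^d + I⁺(z, w)` gives `BetaGe … α ρ' f` for every `ρ'` whose thresholds do not exceed the strict
ones: `⌈ρ' n⌉ ≤ ⌊β₀ n⌋ + 1` for `1 ≤ n ≤ d` (with `β₀ ∈ (1/N)ℕ` any `ρ' ≤ β₀ + 1/(dN)` qualifies — the rounding of brick A).
OURS. [folklore] -/
theorem betaGe_of_mem_sup_betaStrict (x y z w : S) {α β₀ ρ' : ℚ} {d : ℕ}
    (hρ : ∀ n : ℕ, 1 ≤ n → n ≤ d → ⌈ρ' * (n : ℚ)⌉₊ ≤ ⌊β₀ * (n : ℚ)⌋₊ + 1) {f : S}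
    (hf : f ∈ Ideal.span {z, w} ^ d ⊔
      (Ideal.span {x, y} * Ideal.span {z, w} ^ d ⊔
        ⨆ (i : ℕ) (j : ℕ) (_ : i + j < d),
          (Ideal.span {x ^ (⌊α * ((d - i - j : ℕ) : ℚ)⌋₊ + 1)} ⊔
              Ideal.span {x ^ ⌈α * ((d - i - j : ℕ) : ℚ)⌉₊ * y ^ (⌊β₀ * ((d - i - j : ℕ) : ℚ)⌋₊ + 1)}) *
            Ideal.span {z ^ i * w ^ j})) :
    BetaGe x y z w d α ρ' f := by
  unfold BetaGe
  refine SetLike.le_def.mp (sup_le le_sup_left (sup_le ?_ ?_)) hf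
  · exact le_sup_of_le_left Ideal.mul_le_left
  · refine le_sup_of_le_right (iSup_mono fun i => iSup_mono fun j => iSup_mono fun hij => ?_)
    rw [Ideal.sup_mul, Ideal.span_singleton_mul_span_singleton, Ideal.span_singleton_mul_span_singleton, ← mul_assoc,
      ← mul_assoc]
    refine sup_le_sup_left (Ideal.span_singleton_le_span_singleton.mpr ?_) _
    exact mul_dvd_mul_right (mul_dvd_mul_right (mul_dvd_mul_left _
      (pow_dvd_pow y (hρ (d - i - j) (by omega) (by omega)))) _) _

/-- Converse bridge: `BetaGe … α ρ' f` with `ρ'` BEYOND `β₀` (`⌊β₀ n⌋ + 1 ≤ ⌈ρ' n⌉` for `1 ≤ n ≤ d`, e.g. `β₀ < ρ'`) puts `f` in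
`(z, w)^d + I⁺(z, w)`. OURS. [folklore] -/
theorem mem_sup_betaStrict_of_betaGe (x y z w : S) {α β₀ ρ' : ℚ} {d : ℕ}
    (hρ : ∀ n : ℕ, 1 ≤ n → n ≤ d → ⌊β₀ * (n : ℚ)⌋₊ + 1 ≤ ⌈ρ' * (n : ℚ)⌉₊) {f : S} (hf : BetaGe x y z w d α ρ' f) :
    f ∈ Ideal.span {z, w} ^ d ⊔
      (Ideal.span {x, y} * Ideal.span {z, w} ^ d ⊔
        ⨆ (i : ℕ) (j : ℕ) (_ : i + j < d),
          (Ideal.span {x ^ (⌊α * ((d - i - j : ℕ) : ℚ)⌋₊ + 1)} ⊔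
              Ideal.span {x ^ ⌈α * ((d - i - j : ℕ) : ℚ)⌉₊ * y ^ (⌊β₀ * ((d - i - j : ℕ) : ℚ)⌋₊ + 1)}) *
            Ideal.span {z ^ i * w ^ j}) := by
  unfold BetaGe at hf
  refine SetLike.le_def.mp (sup_le le_sup_left ?_) hf
  refine le_sup_of_le_right (le_sup_of_le_right (iSup_mono fun i => iSup_mono fun j => iSup_mono fun hij => ?_))
  rw [Ideal.sup_mul, Ideal.span_singleton_mul_span_singleton, Ideal.span_singleton_mul_span_singleton, ← mul_assoc,
    ← mul_assoc]
  refine sup_le_sup_left (Ideal.span_singleton_le_span_singleton.mpr ?_) _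
  exact mul_dvd_mul_right (mul_dvd_mul_right (mul_dvd_mul_left _
    (pow_dvd_pow y (hρ (d - i - j) (by omega) (by omega)))) _) _

/-- **Elements strictly beyond the vertex keep `α`**: `(z, w)^d + I⁺(z, w) ≤` the `α`-threshold ideal at `α` (`0 ≤ α`), so a
dissolved representative stays in the class `C = {α = α*}` once `α*` is maximal. OURS. [folklore] -/
theorem alphaGe_of_mem_sup_betaStrict (x y z w : S) {α β₀ : ℚ} {d : ℕ} {f : S}
    (hf : f ∈ Ideal.span {z, w} ^ d ⊔
      (Ideal.span {x, y} * Ideal.span {z, w} ^ d ⊔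
        ⨆ (i : ℕ) (j : ℕ) (_ : i + j < d),
          (Ideal.span {x ^ (⌊α * ((d - i - j : ℕ) : ℚ)⌋₊ + 1)} ⊔
              Ideal.span {x ^ ⌈α * ((d - i - j : ℕ) : ℚ)⌉₊ * y ^ (⌊β₀ * ((d - i - j : ℕ) : ℚ)⌋₊ + 1)}) *
            Ideal.span {z ^ i * w ^ j})) :
    AlphaGe x z w d α f := by
  unfold AlphaGe
  refine SetLike.le_def.mp (sup_le le_sup_left (sup_le ?_ ?_)) hf
  · exact le_sup_of_le_left Ideal.mul_le_left
  · refine le_sup_of_le_right (iSup_mono fun i => iSup_mono fun j => iSup_mono fun hij => ?_)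
    rw [Ideal.sup_mul, Ideal.span_singleton_mul_span_singleton, Ideal.span_singleton_mul_span_singleton, ← mul_assoc,
      ← mul_assoc]
    refine sup_le (Ideal.span_singleton_le_span_singleton.mpr ?_) (Ideal.span_singleton_le_span_singleton.mpr ?_)
    · exact mul_dvd_mul_right (mul_dvd_mul_right (pow_dvd_pow x (Nat.ceil_le_floor_add_one _)) _) _
    · exact mul_dvd_mul_right (mul_dvd_mul_right (Dvd.intro _ rfl) _) _

/-! ## §3 The same bridges through res-L0-w41-stub-1's word `BetaGt` («the left vertex is lexicographically beyond `(α, β)`») -/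

/-- `BetaGt x y z w d α β f` IS membership in `(z, w)^d + I⁺(z, w)` (the strict `β`-ideal of the engine file; `(x, y)·(z, w)^d` is
absorbed by `(z, w)^d`). OURS. [folklore] -/
theorem betaGt_iff_mem_sup_betaStrict (x y z w : S) (d : ℕ) (α β : ℚ) (f : S) :
    BetaGt x y z w d α β f ↔
      f ∈ Ideal.span {z, w} ^ d ⊔
        (Ideal.span {x, y} * Ideal.span {z, w} ^ d ⊔
          ⨆ (i : ℕ) (j : ℕ) (_ : i + j < d),
            (Ideal.span {x ^ (⌊α * ((d - i - j : ℕ) : ℚ)⌋₊ + 1)} ⊔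
                Ideal.span {x ^ ⌈α * ((d - i - j : ℕ) : ℚ)⌉₊ * y ^ (⌊β * ((d - i - j : ℕ) : ℚ)⌋₊ + 1)}) *
              Ideal.span {z ^ i * w ^ j}) := by
  unfold BetaGt
  have hw : ∀ i j : ℕ,
      Ideal.span {x ^ (⌊α * ((d - i - j : ℕ) : ℚ)⌋₊ + 1) * z ^ i * w ^ j} ⊔
          Ideal.span {x ^ ⌈α * ((d - i - j : ℕ) : ℚ)⌉₊ * y ^ (⌊β * ((d - i - j : ℕ) : ℚ)⌋₊ + 1) * z ^ i * w ^ j}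
        = (Ideal.span {x ^ (⌊α * ((d - i - j : ℕ) : ℚ)⌋₊ + 1)} ⊔
            Ideal.span {x ^ ⌈α * ((d - i - j : ℕ) : ℚ)⌉₊ * y ^ (⌊β * ((d - i - j : ℕ) : ℚ)⌋₊ + 1)}) *
          Ideal.span ({z ^ i * w ^ j} : Set S) := by
    intro i j
    rw [Ideal.sup_mul, Ideal.span_singleton_mul_span_singleton, Ideal.span_singleton_mul_span_singleton,
      mul_assoc, mul_assoc (x ^ _ * y ^ _)]
  simp_rw [hw]
  rw [← sup_assoc, sup_eq_left.mpr (Ideal.mul_le_left : Ideal.span {x, y} * Ideal.span {z, w} ^ d ≤ Ideal.span {z, w} ^ d)]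

/-- **`BetaGt` does not see moves of `v`-weight `≥ 1` up to the `(z, w)^d`-part**: brick D in the word — if `φ, ψ` have weight `≥ 1`
for `v = (α, β₀)` and `f ≡ P + Q² (mod I⁺(z, w))` with `P ∈ (z + φ, w + ψ)^d`, then `BetaGt x y (z + φ) (w + ψ) d α β₀ (f − Q²)`.
OURS. [folklore] -/
theorem betaGt_sub_sq_of_dissolution (x y z w : S) {α β₀ : ℚ} (hα : 0 ≤ α) (hβ : 0 ≤ β₀) {φ ψ : S}
    (hφ : φ ∈ Ideal.span {x ^ (⌊α⌋₊ + 1)} ⊔ Ideal.span {x ^ ⌈α⌉₊ * y ^ ⌈β₀⌉₊})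
    (hψ : ψ ∈ Ideal.span {x ^ (⌊α⌋₊ + 1)} ⊔ Ideal.span {x ^ ⌈α⌉₊ * y ^ ⌈β₀⌉₊}) {d : ℕ} {f P Q : S}
    (hP : P ∈ Ideal.span {z + φ, w + ψ} ^ d)
    (hf : f - (P + Q ^ 2) ∈ Ideal.span {x, y} * Ideal.span {z, w} ^ d ⊔
        ⨆ (i : ℕ) (j : ℕ) (_ : i + j < d),
          (Ideal.span {x ^ (⌊α * ((d - i - j : ℕ) : ℚ)⌋₊ + 1)} ⊔
              Ideal.span {x ^ ⌈α * ((d - i - j : ℕ) : ℚ)⌉₊ * y ^ (⌊β₀ * ((d - i - j : ℕ) : ℚ)⌋₊ + 1)}) *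
            Ideal.span {z ^ i * w ^ j}) :
    BetaGt x y (z + φ) (w + ψ) d α β₀ (f - Q ^ 2) :=
  (betaGt_iff_mem_sup_betaStrict x y (z + φ) (w + ψ) d α β₀ (f - Q ^ 2)).mpr
    (sub_sq_mem_of_dissolution x y z w hα hβ hφ hψ hP hf)

/-- `BetaGt … α β₀ f ⇒ BetaGe … α ρ' f` for every `ρ'` within the rounding window (`⌈ρ'n⌉ ≤ ⌊β₀n⌋ + 1`, `1 ≤ n ≤ d`). OURS. [folklore] -/
theorem betaGe_of_betaGt (x y z w : S) {α β₀ ρ' : ℚ} {d : ℕ}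
    (hρ : ∀ n : ℕ, 1 ≤ n → n ≤ d → ⌈ρ' * (n : ℚ)⌉₊ ≤ ⌊β₀ * (n : ℚ)⌋₊ + 1) {f : S} (hf : BetaGt x y z w d α β₀ f) :
    BetaGe x y z w d α ρ' f :=
  betaGe_of_mem_sup_betaStrict x y z w hρ ((betaGt_iff_mem_sup_betaStrict x y z w d α β₀ f).mp hf)

/-- `BetaGe … α ρ' f` with `β₀ < ρ'` (`0 ≤ β₀`) ⇒ `BetaGt … α β₀ f`. OURS. [folklore] -/
theorem betaGt_of_betaGe_of_lt (x y z w : S) {α β₀ ρ' : ℚ} (hβ : 0 ≤ β₀) (hlt : β₀ < ρ') {d : ℕ} {f : S}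
    (hf : BetaGe x y z w d α ρ' f) : BetaGt x y z w d α β₀ f :=
  (betaGt_iff_mem_sup_betaStrict x y z w d α β₀ f).mpr
    (mem_sup_betaStrict_of_betaGe x y z w (fun _ hn _ => floor_add_one_le_ceil_of_lt hβ hlt hn) hf)

/-- `BetaGt … α β f ⇒ BetaGe … α β f` (strictly beyond implies not below). OURS. [folklore] -/
theorem betaGe_of_betaGt_self (x y z w : S) {α β : ℚ} {d : ℕ} {f : S} (hf : BetaGt x y z w d α β f) :
    BetaGe x y z w d α β f :=
  betaGe_of_betaGt x y z w (fun _ _ _ => Nat.ceil_le_floor_add_one _) hf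

/-- `BetaGt … α β f ⇒ AlphaGe … α f` (a vertex beyond `(α, β)` lies on or right of the column `a = α`). OURS. [folklore] -/
theorem alphaGe_of_betaGt (x y z w : S) {α β : ℚ} {d : ℕ} {f : S} (hf : BetaGt x y z w d α β f) : AlphaGe x z w d α f :=
  alphaGe_of_mem_sup_betaStrict x y z w ((betaGt_iff_mem_sup_betaStrict x y z w d α β f).mp hf)

end Summit.ResolutionOfSingularities.ResolutionOfSingularities.Theorems.SwitchingDichotomy.BetaPolygonMoves

end
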